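import Literature.Computability.AlgebraicComplexity.ConstituentStageCounts
import Literature.Computability.AlgebraicComplexity.ShannonEntropyModulus
import Literature.Computability.AlgebraicComplexity.LaserSymmetrizationEntropy
import HarnessLib

/-!
# The classes of Def. 6.12 are large for admitted `Z`-blocks
(Vassilevska Williams–Xu–Xu–Zhou 2024, §6.6, proof of Claim 6.13: "the number of `Z_K̂` with the desired
complete split distributions `{ξ_{Z,t}}` is `2^{∑_t H(ξ_{Z,t}) A_{t,1} n_t ± o(n)}` … the `L_∞` distance
between `{ξ_{Z,t}}` and `{β_{Z,t}}` is at most `ε`") — proved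

Topic `Literature/Computability/AlgebraicComplexity`.  The denominator of `p*_comp` in Claim 6.13 of
Vassilevska Williams–Xu–Xu–Zhou, *New bounds for matrix multiplication: from alpha to omega* (SODA 2024,
arXiv:2307.07970) counts the level-1 `Z`-blocks `K̂'` with the same level-`ℓ` complete split
distributions `{ξ_{Z,t}}` as a given `K̂` (`ConstituentStageCompatCount.shapeClass K̂`), by Lemma 3.3, and
compares `H(ξ_{Z,t})` with `H(β_{Z,t})` for blocks of the input, whose splits are `ε`-close to `β_{Z,t}`.
This file PROVES the exact lower bound used as the hypothesis `m ≤ #class` of the parameter choice: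

* `pairSplit`, `shannonEntropy_pairSplit_eq` — the distribution of (left shape, right shape) pairs of `K̂`
  on term `t` is the complete split distribution of `merge(K̂)` on `τ⁻¹(t)` read through `halvesEquiv`;
* `two_rpow_le_mul_card_shapeClass` — **`2^{∑_t n_t H(ξ_{Z,t}(K̂))} ≤ (∏_t (n_t+1)^{9^c}) · #shapeClass(K̂)`**
  (the class is a multi-class type class of pair words; Lemma 3.3);
* `two_rpow_le_mul_card_shapeClass_of_admitted` — **for `K̂` merging to a level-1 `Z`-block of the input
  `𝒯_{τ,L,ε}`, `2^{∑_t n_t (H(β_{Z,t}) − 9^c m(ε))} ≤ (∏_t (n_t+1)^{9^c}) · #shapeClass(K̂)`**, `m` the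
  entropy modulus (`ShannonEntropyModulus.lean`), `β_{Z,t} = γ_Z` of the level-`ℓ` term `t`.

Everything is proved; one definition (`pairSplit`); no named facts.

## References

* V. Vassilevska Williams, Y. Xu, Z. Xu, R. Zhou, *New bounds for matrix multiplication: from alpha
  to omega*, SODA 2024, arXiv:2307.07970 (held: `paper:arxiv-2307.07970`), §6.6 (Claim 6.13, proof:
  the second quantity; "the L∞ distance … is at most ε"), Lemma 3.3. [VassilevskaWilliamsXuXuZhou2024]
-/

noncomputable section

open scoped BigOperators
open Finset

namespace Literature.Computability.AlgebraicComplexity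

/-! ## The pair split distribution of a level-1 sequence on half-chunks -/

section PairSplit

variable {c n s : ℕ} (τ : Fin n → Fin s)

/-- **`ξ_{Z,t}(K̂)` on pairs**: the distribution of (left shape, right shape) over the chunks of term `t`
(the level-`ℓ` complete split distribution of `K̂`, read on pairs of half shapes). [cite: VassilevskaWilliamsXuXuZhou2024, Def. 6.12 ("K̂ has level-ℓ complete split distributions {ξ_{Z,t}}")] -/
def pairSplit (t : Fin s) (Kh : Fin (n + n) → Fin c → Fin 3) : (Fin c → Fin 3) × (Fin c → Fin 3) → ℝ :=
  fun ab => (countOn (classOf τ t) (halfPairs Kh) ab : ℝ) / Fintype.card {u // τ u = t}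

/-- The pair split distribution is the complete split distribution of the merge, through `halvesEquiv`.
[cite: VassilevskaWilliamsXuXuZhou2024, Def. 3.5 and §6.2] -/
theorem pairSplit_eq_completeSplitOn (t : Fin s) (Kh : Fin (n + n) → Fin c → Fin 3) (ab : (Fin c → Fin 3) × (Fin c → Fin 3)) :
    pairSplit τ t Kh ab = completeSplitOn (mergeHalves Kh) (classOf τ t) (halvesEquiv.symm ab) := by
  have key : ∀ u : Fin n, halfPairs Kh u = ab ↔ mergeHalves Kh u = halvesEquiv.symm ab := by
    intro u
    rw [halfPairs_apply, mergeHalves_apply, show (halvesEquiv.symm ab : Fin (c + c) → Fin 3) = Fin.append ab.1 ab.2 from rfl,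
      append_eq_iff_halves, leftHalf_append, rightHalf_append, Prod.ext_iff]
  rw [pairSplit, completeSplitOn_apply, card_subtype_classOf, countOn_apply, Finset.filter_congr (fun u _ => key u)]

/-- **`H(ξ_{Z,t}(K̂)) = H(split(merge K̂, τ⁻¹(t)))`.** [folklore] -/
theorem shannonEntropy_pairSplit_eq (t : Fin s) (Kh : Fin (n + n) → Fin c → Fin 3) :
    shannonEntropy (pairSplit τ t Kh) = shannonEntropy (completeSplitOn (mergeHalves Kh) (classOf τ t)) := by
  have : pairSplit τ t Kh = completeSplitOn (mergeHalves Kh) (classOf τ t) ∘ ⇑(halvesEquiv (α := Fin 3) (c := c)).symm := by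
    funext ab; exact pairSplit_eq_completeSplitOn τ t Kh ab
  rw [this, shannonEntropy_comp_equiv]

end PairSplit

/-! ## The lower bound on the classes -/

namespace ConstituentRegion

open scoped Classical

variable {c n s M : ℕ} {D : ConstituentRegion c n s M}

/-- The number of pairs of half shapes: `9^c`. [folklore] -/
theorem card_halfShapePairs : Fintype.card ((Fin c → Fin 3) × (Fin c → Fin 3)) = 9 ^ c := by
  rw [Fintype.card_prod, Fintype.card_fun, Fintype.card_fin, Fintype.card_fin, ← mul_pow]; norm_num

/-- **`2^{∑_t n_t H(ξ_{Z,t}(K̂))} ≤ (∏_t (n_t+1)^{9^c}) · #shapeClass(K̂)`** (the class is the multi-class type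
class of the pair word of `K̂`; Lemma 3.3). [cite: VassilevskaWilliamsXuXuZhou2024, Claim 6.13 (proof, "the number of Z_K̂ with the desired complete split distributions {ξ_{Z,t}} is 2^{∑_t H(ξ_{Z,t}) A_{t,1} n_t ± o(n)}")] -/
theorem two_rpow_le_mul_card_shapeClass (Kh : Fin (n + n) → Fin c → Fin 3) :
    (2 : ℝ) ^ (∑ t, (Fintype.card {u // D.τ u = t} : ℝ) * shannonEntropy (pairSplit D.τ t Kh)) ≤
      (∏ t, ((Fintype.card {u // D.τ u = t} : ℝ) + 1) ^ (9 ^ c)) * (D.shapeClass Kh).card := by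
  have hk : ∀ t, ∑ a, countOn (classOf D.τ t) (halfPairs Kh) a = Fintype.card {u // D.τ u = t} := fun t => by
    rw [card_subtype_classOf]; exact sum_countOn _ _
  have h := two_rpow_le_mul_card_multiTypeClass D.τ (fun t a => countOn (classOf D.τ t) (halfPairs Kh) a) hk
  rw [card_halfShapePairs] at h
  rw [shapeClass, card_pairTypeClass_eq]
  exact h

/-- **For an admitted `Z`-block the class is as large as `2^{∑_t n_t H(β_{Z,t})}` up to `ε`-losses**:
if `merge(K̂)` is a level-1 `Z`-block of the input `𝒯_{τ,L,ε}` (`0 ≤ ε ≤ 1`, `β_{Z,t} = γ_Z` of term `t`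
valued in `[0,1]`), then `2^{∑_t n_t (H(β_{Z,t}) − 3^{2c} m(ε))} ≤ (∏_t (n_t+1)^{9^c}) · #shapeClass(K̂)`.
[cite: VassilevskaWilliamsXuXuZhou2024, Claim 6.13 (proof: "the L∞ distance between {ξ_{Z,t}} and {β_{Z,t}} is at most ε") and §6.6 ("for every level-1 Z-block Z_K̂ that appears in the input …")] -/
theorem two_rpow_le_mul_card_shapeClass_of_admitted (hε1 : D.ε ≤ 1)
    (hγ0 : ∀ t σ, 0 ≤ (D.L t).γZ σ) (hγ1 : ∀ t σ, (D.L t).γZ σ ≤ 1)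
    {Kh : Fin (n + n) → Fin c → Fin 3} (hadm : mergeHalves Kh ∈ levelBlocksZ D.τ D.L D.ε) :
    (2 : ℝ) ^ (∑ t, (Fintype.card {u // D.τ u = t} : ℝ) *
        (shannonEntropy (D.L t).γZ - Fintype.card (Fin (c + c) → Fin 3) * entropyModulus D.ε)) ≤
      (∏ t, ((Fintype.card {u // D.τ u = t} : ℝ) + 1) ^ (9 ^ c)) * (D.shapeClass Kh).card := by
  refine le_trans ?_ (two_rpow_le_mul_card_shapeClass Kh)
  refine Real.rpow_le_rpow_of_exponent_le one_le_two (sum_le_sum fun t _ => ?_)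
  rcases Nat.eq_zero_or_pos (Fintype.card {u // D.τ u = t}) with ht | ht
  · rw [ht]; simp
  · refine mul_le_mul_of_nonneg_left ?_ (Nat.cast_nonneg _)
    rw [shannonEntropy_pairSplit_eq]
    have hne : (classOf D.τ t).Nonempty := by
      rw [← Finset.card_pos, ← card_subtype_classOf]; exact ht
    have hsplit := (mem_admissibleSeqs.1 hadm).2 t hne
    exact le_shannonEntropy_add_of_abs_sub_le (completeSplitOn_nonneg _ _) (completeSplitOn_le_one _ _) (hγ0 t) (hγ1 t) hε1 hsplit

end ConstituentRegion

end Literature.Computability.AlgebraicComplexity
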